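import Summits.CriticalPhenomena.CardyFormulaZ2.Theorems.CardyComplexConeParafermionToSLESixFamiliesDiamondTraceSideChart
import Literature.Probability.Percolation.HalfPlaneArmDiagonalInputs
import Literature.Probability.Percolation.IsoradialTranslation
import Literature.Probability.LatticeModels.CornerPermutation
import Literature.Probability.LatticeModels.DiscreteFaceBoundary
import HarnessLib

/-!
# The four side frames of a diamond as half-plane coordinate pairs: tangential / normal lattice coordinates, their
# isoradial drawings, and the lattice automorphisms between the frames (line `potential-darboux-picard-diamond`, S3 (c), part 2)

Crux `ParafermionToSLESixFamilies` (stmt-CriticalPhenomena-11389), line `potential-darboux-picard-diamond`, conditional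
helper `freeTouchLower_of_diagArmLower` of S3. The tree's half-plane gluing toolkit (`Literature.Probability.Percolation.HalfPlaneArm`)
is written for an abstract pair of integer coordinates `X, Y` of `ℤ²` that are `1`-Lipschitz along edges, jointly
injective, and the real and imaginary parts of an isoradial rhombic drawing. For side `k` of a diamond discretisation
(touch darts of orientation `j = k + 2`, `…DiamondTraceSideLayers`) the relevant pair is

* `layerFn (k + 3)` — the coordinate ALONG the side, and
* the DEPTH `n k − 2 − layerFn (k + 2)` below the touch row `layerFn (k + 2) = n k − 2` (`n k` the last layer inside;
  local notation `dp[n, k, v]`), so that the touch row is at depth `0` and the interior of the diamond at depth `≥ 0`;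

this file proves the toolkit's hypotheses for all four `k` at once: the Lipschitz and injectivity properties
(`layerFn_le_of_adj`, `dp_le_of_adj`, `tng_dp_injective`), the drawing `SE[n, k]` — Grimmett–Manolescu's isoradial square
lattice `G_{θ, θ+π/2}` (`= e^{iθ}·(col + i·hgtOf)`) for `θ = −π/2, π, π/2, 0`, translated — with real part the tangential
coordinate and imaginary part the depth (`sideEmb_re`, `sideEmb_im`, `sideEmb_isIsoradial`, `sideEmb_isRhombicTiling`), the
lattice rotation `SR[k]` carrying the diagonal coordinates `(col, hgtOf)` to `(layerFn (k+3), −layerFn (k+2))`, and its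
based version `SI[k, x]` (origin `↦ x`), along which the events of the gluing are transported
(`…DiamondTouchLowerTransport.lean`). Everything is written with local notation (no new definitions).
-/

noncomputable section

namespace Summit.CriticalPhenomena.CardyFormulaZ2.Cruxes.ParafermionToSLESixFamilies.PotentialDarbouxPicardDiamond

open MeasureTheory Set Complex
open Literature.Probability Literature.Probability.LatticeModels Literature.Probability.Percolation
open Literature.Probability.Percolation.TrackExchange (col hgtOf)

/-- The depth of `v` below the touch row of side `k` (last inside layer `n k`). -/
local notation3 "dp[" n ", " k ", " v "]" => (n : Fin 4 → ℤ) k - 2 - layerFn (k + 2) v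

/-- The rotation of side `k`. -/
local notation3 "SR[" k "]" => (![zdSignedPermIso (Equiv.swap 0 1) ![-1, 1], zdSignedPermIso 1 (fun _ => -1),
    zdSignedPermIso (Equiv.swap 0 1) ![1, -1], zdSignedPermIso 1 (fun _ => 1)] : Fin 4 → (zdGraph 2 ≃g zdGraph 2)) k

/-- The lattice automorphism based at the site `x` of side `k`. -/
local notation3 "SI[" k ", " x "]" => (zdShiftIso ((SR[k]).symm x)).trans SR[k]

/-- The angle of the drawing of side `k`. -/
local notation3 "SA[" k "]" => (![-(Real.pi / 2), Real.pi, Real.pi / 2, 0] : Fin 4 → ℝ) k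

/-- The isoradial drawing of side `k`. -/
local notation3 "SE[" n ", " k "]" => (gmEmbedding (fun _ => SA[k]) (fun _ => SA[k] + Real.pi / 2)).translate
    ((((n : Fin 4 → ℤ) k - 2 : ℤ) : ℂ) * I)

/-! ## The tangential and normal coordinates of a side -/

/-- `layerFn 2` is the diagonal coordinate `col = x₀ − x₁`. -/
theorem layerFn_two (x : Site 2) : layerFn 2 x = col x := by simp [layerFn, col]

/-- `layerFn 3` is the diagonal coordinate `hgtOf = x₀ + x₁`. -/
theorem layerFn_three (x : Site 2) : layerFn 3 x = hgtOf x := by simp [layerFn, hgtOf]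

/-- Opposite orientations have opposite layer functions. -/
theorem layerFn_add_two (j : Fin 4) (x : Site 2) : layerFn (j + 2) x = -layerFn j x := by
  fin_cases j <;> simp [layerFn]

/-- The layer functions move by one along every lattice edge. -/
theorem layerFn_le_of_adj (j : Fin 4) (u v : Site 2) (h : (zdGraph 2).Adj u v) : layerFn j v ≤ layerFn j u + 1 := by
  rw [zdGraph_adj_iff] at h
  obtain ⟨i, hi | hi⟩ := h
  · have h0 := congrFun hi 0
    have h1 := congrFun hi 1
    fin_cases i <;> fin_cases j <;> simp [layerFn] at h0 h1 ⊢ <;> omega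
  · have h0 := congrFun hi 0
    have h1 := congrFun hi 1
    fin_cases i <;> fin_cases j <;> simp [layerFn] at h0 h1 ⊢ <;> omega

/-- The depth moves by at most one along an edge. -/
theorem dp_le_of_adj (n : Fin 4 → ℤ) (k : Fin 4) (u v : Site 2) (h : (zdGraph 2).Adj u v) : dp[n, k, v] ≤ dp[n, k, u] + 1 := by
  have := layerFn_le_of_adj (k + 2) v u h.symm
  omega

/-- A site is determined by its two side coordinates. -/
theorem tng_dp_injective (n : Fin 4 → ℤ) (k : Fin 4) : Function.Injective fun v : Site 2 => (layerFn (k + 3) v, dp[n, k, v]) := by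
  intro v w h
  simp only [Prod.mk.injEq] at h
  refine eq_of_layerFn_eq (k + 2) (by omega) ?_
  rw [fin4_add_two_add_one]
  exact h.1

/-! ## The isoradial drawing of a side frame -/

/-- The drawing of a side is isoradial. -/
theorem sideEmb_isIsoradial (n : Fin 4 → ℤ) (k : Fin 4) : (SE[n, k]).IsIsoradial :=
  (isIsoradial_gmEmbedding fun i j => by constructor <;> simp <;> linarith [Real.pi_pos]).translate

/-- The drawing of a side is a rhombic tiling. -/
theorem sideEmb_isRhombicTiling (n : Fin 4 → ℤ) (k : Fin 4) : (SE[n, k]).IsRhombicTiling :=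
  (isRhombicTiling_gmEmbedding (ε := Real.pi / 8) (by positivity)
    fun i j => by constructor <;> simp <;> linarith [Real.pi_pos]).translate

/-- `G_{θ, θ + π/2}` is the straight drawing `col + i hgtOf` turned by `e^{iθ}`. -/
theorem gmEmbedding_const_z (θ : ℝ) (v : Site 2) :
    (gmEmbedding (fun _ => θ) (fun _ => θ + Real.pi / 2)).z v = cexp ((θ : ℂ) * I) * ((col v : ℂ) + (hgtOf v : ℂ) * I) := by
  rw [gmEmbedding_z]
  unfold gmVertex gmDiamond
  rw [trackHeight_const, trackHeight_const]
  have h : cexp (((θ + Real.pi / 2 : ℝ) : ℂ) * I) = cexp ((θ : ℂ) * I) * I := by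
    rw [show ((θ + Real.pi / 2 : ℝ) : ℂ) * I = (θ : ℂ) * I + (Real.pi / 2 : ℂ) * I by push_cast; ring, Complex.exp_add,
      Complex.exp_mul_I (Real.pi / 2 : ℂ)]
    rw [show (Real.pi / 2 : ℂ) = ((Real.pi / 2 : ℝ) : ℂ) by push_cast; ring, ← Complex.ofReal_cos, ← Complex.ofReal_sin,
      Real.cos_pi_div_two, Real.sin_pi_div_two]
    simp
  rw [h]
  simp only [col, hgtOf]
  push_cast
  ring

/-- The unit `e^{iθ}` of each side: `−i, −1, i, 1`. -/
theorem cexp_sideAngle (k : Fin 4) : cexp ((SA[k] : ℂ) * I) = ![-I, -1, I, 1] k := by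
  fin_cases k
  · simp only [Fin.zero_eta, Matrix.cons_val_zero]
    rw [Complex.ofReal_neg, neg_mul, Complex.exp_neg, show ((Real.pi / 2 : ℝ) : ℂ) * I = (Real.pi / 2 : ℂ) * I by push_cast; ring,
      Complex.exp_pi_div_two_mul_I, Complex.inv_I]
  · simp only [Fin.mk_one, Matrix.cons_val_one, Matrix.cons_val_zero]
    rw [Complex.exp_pi_mul_I]
  · simp only [Fin.reduceFinMk, Matrix.cons_val]
    rw [show ((Real.pi / 2 : ℝ) : ℂ) * I = (Real.pi / 2 : ℂ) * I by push_cast; ring, Complex.exp_pi_div_two_mul_I]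
  · simp

/-- **The real part of the drawing of side `k` is the tangential coordinate.** -/
theorem sideEmb_re (n : Fin 4 → ℤ) (k : Fin 4) (v : Site 2) : ((SE[n, k]).z v).re = 1 * ((layerFn (k + 3) v : ℤ) : ℝ) := by
  rw [RhombicEmbedding.translate_z, gmEmbedding_const_z, cexp_sideAngle, one_mul]
  fin_cases k <;> simp [layerFn, col, hgtOf]

/-- **The imaginary part of the drawing of side `k` is the depth.** -/
theorem sideEmb_im (n : Fin 4 → ℤ) (k : Fin 4) (v : Site 2) : ((SE[n, k]).z v).im = 1 * ((dp[n, k, v] : ℤ) : ℝ) := by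
  rw [RhombicEmbedding.translate_z, gmEmbedding_const_z, cexp_sideAngle, one_mul]
  fin_cases k <;> simp [layerFn, col, hgtOf] <;> ring

/-! ## The rotation of a side frame and the automorphism based at a site -/

/-- The rotation of side `k` carries `col` to the tangential coordinate. -/
theorem tng_sideRot (k : Fin 4) (v : Site 2) : layerFn (k + 3) (SR[k] v) = col v + 0 := by
  have e3 : ∀ i : Fin 2, (Equiv.symm (1 : Equiv.Perm (Fin 2))) i = i := fun i => rfl
  fin_cases k <;> simp [layerFn, col, zdSignedPermIso_apply, e3] <;> ring

/-- The rotation of side `k` carries `hgtOf` to minus the layer function of the side. -/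
theorem layerFn_sideRot (k : Fin 4) (v : Site 2) : layerFn (k + 2) (SR[k] v) = -hgtOf v := by
  have e3 : ∀ i : Fin 2, (Equiv.symm (1 : Equiv.Perm (Fin 2))) i = i := fun i => rfl
  fin_cases k <;> simp [layerFn, hgtOf, zdSignedPermIso_apply, e3] <;> ring

/-- The rotation of side `k` carries `hgtOf` to the depth, up to the constant `n k − 2`. -/
theorem dp_sideRot (n : Fin 4 → ℤ) (k : Fin 4) (v : Site 2) : dp[n, k, SR[k] v] = hgtOf v + (n k - 2) := by
  rw [layerFn_sideRot]; ring

/-- `col` is additive. -/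
theorem col_add (u v : Site 2) : col (u + v) = col u + col v := by
  simp only [col, Pi.add_apply]; ring

/-- `hgtOf` is additive. -/
theorem hgtOf_add (u v : Site 2) : hgtOf (u + v) = hgtOf u + hgtOf v := by
  simp only [hgtOf, Pi.add_apply]; ring

/-- Unfolding the based automorphism. -/
theorem siteIso_apply (k : Fin 4) (x v : Site 2) : SI[k, x] v = SR[k] (v + (SR[k]).symm x) := rfl

/-- The based automorphism maps the origin to the base site. -/
theorem siteIso_zero (k : Fin 4) (x : Site 2) : SI[k, x] 0 = x := by
  rw [siteIso_apply, zero_add, RelIso.apply_symm_apply]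

/-- The based automorphism carries `col` to the tangential coordinate, up to a constant. -/
theorem tng_siteIso (k : Fin 4) (x v : Site 2) : layerFn (k + 3) (SI[k, x] v) = col v + col ((SR[k]).symm x) := by
  rw [siteIso_apply, tng_sideRot, add_zero, col_add]

/-- The based automorphism carries `hgtOf` to the depth, up to the depth of the base site. -/
theorem dp_siteIso (n : Fin 4 → ℤ) (k : Fin 4) (x v : Site 2) : dp[n, k, SI[k, x] v] = hgtOf v + dp[n, k, x] := by
  have hx : dp[n, k, x] = dp[n, k, SR[k] ((SR[k]).symm x)] := by rw [RelIso.apply_symm_apply]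
  rw [siteIso_apply, dp_sideRot, hgtOf_add, hx, dp_sideRot]
  ring

/-- **Registered form (helper of `freeTouchLower_of_diagArmLower`): the drawing of side `k` has real part the tangential
coordinate and imaginary part the depth.** -/
theorem touchLower_sideEmb_re_im : ∀ (n : Fin 4 → ℤ) (k : Fin 4) (v : Site 2), (((gmEmbedding (fun _ => (![-(Real.pi / 2), Real.pi, Real.pi / 2, 0] : Fin 4 → ℝ) k) (fun _ => (![-(Real.pi / 2), Real.pi, Real.pi / 2, 0] : Fin 4 → ℝ) k + Real.pi / 2)).translate ((((n : Fin 4 → ℤ) k - 2 : ℤ) : ℂ) * I)).z v).re = 1 * ((layerFn (k + 3) v : ℤ) : ℝ) ∧ (((gmEmbedding (fun _ => (![-(Real.pi / 2), Real.pi, Real.pi / 2, 0] : Fin 4 → ℝ) k) (fun _ => (![-(Real.pi / 2), Real.pi, Real.pi / 2, 0] : Fin 4 → ℝ) k + Real.pi / 2)).translate ((((n : Fin 4 → ℤ) k - 2 : ℤ) : ℂ) * I)).z v).im = 1 * (((n k - 2 - layerFn (k + 2) v : ℤ) : ℤ) : ℝ) :=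
  fun n k v => ⟨sideEmb_re n k v, sideEmb_im n k v⟩

end Summit.CriticalPhenomena.CardyFormulaZ2.Cruxes.ParafermionToSLESixFamilies.PotentialDarbouxPicardDiamond

end
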